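import Mathlib
import HarnessLib
import Literature.Analysis.Distribution.LaplaceExpSumsCalculus
import Summits.HubbardSuperconductivity.HubbardSuperconductivity.Theorems.KLProgrammeKLRegimeCountertermFrameCurveLipschitz

/-!
# Route `KLProgramme` — ENGINE child `KLRegimeEngineV11` (stmt-HubbardSuperconductivity-19823), two-leg stubs: QUANTITATIVE `C⁴`
# BOUNDS OF THE FRAME'S FERMI-POINT MAP, part A — the perturbed LEVEL FUNCTION `G(θ,t) = ε₀(t·dir θ) − K(t·dir θ)` on `ℝ × ℝ`:
# derivative bounds to order 4 and its partials as `C³` functions (cell gate-hubbard-kl, seat p1b g5)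

The second input of `twoLegAngularG_of_curve_bounds` (`…SplitTwoLegReductions`): for a frame `K` with `‖Dʲ(frameShift K)‖ ≤ A` (`j ≤ 2`,
`2A < Dt_min`, `[μ − A, μ + A]` in the level range of `B : BandBounds a b` — p4's hypotheses) and `‖Dʲ(frameShift K)‖ ≤ A'` (`j ≤ 4`), the
Fermi-point map `γ(θ) = toLp 2 (klFermiPoint μ K θ)` has `‖Dⁱγ(θ)‖ ≤ Dⁱ`, `1 ≤ i ≤ 4`, with `D` explicit in `(A', Dt_min − 2A)`.
This part: §1 derivative bounds of the level function (chain rule `norm_iteratedFDeriv_comp_le` through the polar map `(θ,t) ↦ t·dir θ` with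
`‖DⁿP‖ ≤ |t| + n`, the free band `‖Dⁱε₀‖ ≤ 4`, the frame `‖Dⁱδ_K‖ ≤ 2ⁱA'`): `‖DʲG(θ,t)‖ ≤ j!·(4 + 16A')·9ʲ` for `|t| ≤ 5`, `j ≤ 4`;
§2 the partials `∂_θ G = DG[(1,0)]`, `∂_t G = DG[(0,1)]` (p4's closed forms `rayDispersionDθ/Dt + Dδ_K[…]` identified with the Fréchet
partials) are `C³` with `‖Dⁱ ∂G‖ ≤ ‖D^{i+1} G‖`.  Part B (`…FermiPointC4Bounds`) runs the bootstrap of `…ImplicitRadiusDerivBounds` on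
`u_K` and assembles `γ = toLp ∘ (u_K·dir)`.  Proofs only.
-/

noncomputable section

namespace Summit.HubbardSuperconductivity.HubbardSuperconductivity.Theorems.PerturbedFermiCurve

set_option linter.dupNamespace false -- summit = problem name (single-conjunct summit), D-0017

open Real Set Finset
open Literature.MathematicalPhysics.QuantumLattice Literature.MathematicalPhysics.QuantumLattice.BandSectorCounting
open Summit.HubbardSuperconductivity.HubbardSuperconductivity.Theorems.DispersionFlow
open Summit.HubbardSuperconductivity.HubbardSuperconductivity.Theorems.KLRegimeSplit

/-! ## §1 The level function `G = (ε₀ + δ_K) ∘ P`, `P(θ,t) = t·dir θ`: derivative bounds -/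

/-- **All derivatives of the free band are bounded by `4`** on `Fin 2 → ℝ` (sup norm): `‖Dⁱ ε₀(k)‖ ≤ 4`, `ε₀(k) = −2(cos k₀ + cos k₁)`. -/
theorem norm_iteratedFDeriv_sqDispersion_le (i : ℕ) (k : Fin 2 → ℝ) : ‖iteratedFDeriv ℝ i sqDispersion k‖ ≤ 4 := by
  have hproj : ∀ c : Fin 2, ‖iteratedFDeriv ℝ i (fun k : Fin 2 → ℝ => Real.cos (k c)) k‖ ≤ 1 := by
    intro c
    set Lc : (Fin 2 → ℝ) →L[ℝ] ℝ := ContinuousLinearMap.proj c with hLc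
    have hfun : (fun k : Fin 2 → ℝ => Real.cos (k c)) = Real.cos ∘ Lc := by funext k; simp [hLc]
    have hnL : ‖Lc‖ ≤ 1 := ContinuousLinearMap.opNorm_le_bound _ zero_le_one fun v => by
      rw [one_mul]; simpa [hLc] using norm_le_pi_norm v c
    rw [hfun, ContinuousLinearMap.iteratedFDeriv_comp_right Lc Real.contDiff_cos k (i := i) le_top]
    refine (ContinuousMultilinearMap.norm_compContinuousLinearMap_le _ _).trans ?_
    rw [Finset.prod_const, Finset.card_univ, Fintype.card_fin, norm_iteratedFDeriv_eq_norm_iteratedDeriv, Real.norm_eq_abs]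
    calc |iteratedDeriv i Real.cos (Lc k)| * ‖Lc‖ ^ i ≤ 1 * 1 ^ i :=
          mul_le_mul (Real.abs_iteratedDeriv_cos_le_one i _) (pow_le_pow_left₀ (norm_nonneg _) hnL i) (by positivity)
            zero_le_one
      _ = 1 := by simp
  have hc0 : ContDiff ℝ i (fun k : Fin 2 → ℝ => Real.cos (k 0)) := Real.contDiff_cos.comp (contDiff_apply ℝ ℝ 0)
  have hc1 : ContDiff ℝ i (fun k : Fin 2 → ℝ => Real.cos (k 1)) := Real.contDiff_cos.comp (contDiff_apply ℝ ℝ 1)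
  have hfun : sqDispersion = (-2 : ℝ) • ((fun k : Fin 2 → ℝ => Real.cos (k 0)) + fun k : Fin 2 → ℝ => Real.cos (k 1)) := by
    funext k; simp [sqDispersion, smul_eq_mul]
  have hsum : ContDiff ℝ i ((fun k : Fin 2 → ℝ => Real.cos (k 0)) + fun k : Fin 2 → ℝ => Real.cos (k 1)) := hc0.add hc1
  rw [hfun, iteratedFDeriv_const_smul_apply hsum.contDiffAt, norm_smul,
    iteratedFDeriv_add_apply hc0.contDiffAt hc1.contDiffAt]
  calc ‖(-2 : ℝ)‖ * ‖iteratedFDeriv ℝ i (fun k : Fin 2 → ℝ => Real.cos (k 0)) k +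
        iteratedFDeriv ℝ i (fun k : Fin 2 → ℝ => Real.cos (k 1)) k‖ ≤ 2 * (1 + 1) := by
        rw [show ‖(-2 : ℝ)‖ = 2 by norm_num]
        exact mul_le_mul_of_nonneg_left ((norm_add_le _ _).trans (add_le_add (hproj 0) (hproj 1))) (by norm_num)
    _ = 4 := by norm_num

/-- **The frame's sizes transported to `Fin 2 → ℝ`, any order**: `‖Dʲ(frameShift K)‖ ≤ A'` on `Momentum` for `j ≤ N` gives
`‖Dʲ δ_K(k)‖ ≤ A'·2ʲ` for `j ≤ N` (`δ_K = frameShift K ∘ toLp`, `‖toLp‖ ≤ 2`; p4's `norm_iteratedFDeriv_frameShift_toLp_le` is `N = 2`). -/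
theorem norm_iteratedFDeriv_frameShift_toLp_le_of_order {K : TrigPolyC4v} {A' : ℝ} {N : ℕ}
    (hA : ∀ p : Momentum, ∀ j ≤ N, ‖iteratedFDeriv ℝ j (frameShift K) p‖ ≤ A') (k : Fin 2 → ℝ) {j : ℕ} (hj : j ≤ N) :
    ‖iteratedFDeriv ℝ j (fun k : Fin 2 → ℝ => frameShift K (WithLp.toLp 2 k)) k‖ ≤ A' * 2 ^ j := by
  set T := ((EuclideanSpace.equiv (Fin 2) ℝ).symm : (Fin 2 → ℝ) →L[ℝ] Momentum) with hT
  have hC : ContDiff ℝ N (frameShift K) := contDiff_frameShift K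
  rw [frameShift_toLp_eq_comp, ContinuousLinearMap.iteratedFDeriv_comp_right T hC k (by exact_mod_cast hj)]
  have h1 := ContinuousMultilinearMap.norm_compContinuousLinearMap_le (iteratedFDeriv ℝ j (frameShift K) (T k))
    (fun _ : Fin j => T)
  have hA0 : 0 ≤ A' := le_trans (norm_nonneg _) (hA (T k) 0 (Nat.zero_le _))
  calc _ ≤ ‖iteratedFDeriv ℝ j (frameShift K) (T k)‖ * ∏ _i : Fin j, ‖T‖ := h1
    _ ≤ A' * 2 ^ j := by
        rw [Finset.prod_const, Finset.card_univ, Fintype.card_fin]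
        exact mul_le_mul (hA _ j hj) (pow_le_pow_left₀ (norm_nonneg _) norm_toLpCLM_le j) (by positivity) hA0

/-- **All derivatives of the direction map are bounded by `1`**: `‖Dⁱ dir(θ)‖ ≤ 1` (components `cos^{(i)}`, `sin^{(i)}`; sup norm). -/
theorem norm_iteratedFDeriv_dir_le (i : ℕ) (θ : ℝ) : ‖iteratedFDeriv ℝ i dir θ‖ ≤ 1 := by
  have hdir : dir = fun θ : ℝ => fun c : Fin 2 => (![Real.cos θ, Real.sin θ] : Fin 2 → ℝ) c := by
    funext θ; rfl
  have hφ' : ∀ c : Fin 2, ContDiff ℝ (⊤ : ℕ∞) (fun θ : ℝ => (![Real.cos θ, Real.sin θ] : Fin 2 → ℝ) c) := by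
    intro c; fin_cases c
    · simpa using Real.contDiff_cos
    · simpa using Real.contDiff_sin
  rw [hdir]
  refine Literature.Analysis.Distribution.norm_iteratedFDeriv_pi_le hφ' i θ zero_le_one fun c => ?_
  fin_cases c
  · change ‖iteratedFDeriv ℝ i (fun θ : ℝ => Real.cos θ) θ‖ ≤ 1
    rw [norm_iteratedFDeriv_eq_norm_iteratedDeriv, Real.norm_eq_abs]
    exact Real.abs_iteratedDeriv_cos_le_one i θ
  · change ‖iteratedFDeriv ℝ i (fun θ : ℝ => Real.sin θ) θ‖ ≤ 1
    rw [norm_iteratedFDeriv_eq_norm_iteratedDeriv, Real.norm_eq_abs]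
    exact Real.abs_iteratedDeriv_sin_le_one i θ

/-- Derivatives of the second projection of `ℝ × ℝ`: `‖D⁰‖ = |t|`, `‖D¹‖ ≤ 1`, `D^{≥2} = 0`. -/
theorem norm_iteratedFDeriv_snd_le (i : ℕ) (p : ℝ × ℝ) :
    ‖iteratedFDeriv ℝ i (fun p : ℝ × ℝ => p.2) p‖ ≤ if i = 0 then |p.2| else if i = 1 then 1 else 0 := by
  have hsndCLM : (fun p : ℝ × ℝ => p.2) = (ContinuousLinearMap.snd ℝ ℝ ℝ : ℝ × ℝ → ℝ) := rfl
  have hfd : fderiv ℝ (fun p : ℝ × ℝ => p.2) = fun _ => ContinuousLinearMap.snd ℝ ℝ ℝ := by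
    funext x; rw [hsndCLM, ContinuousLinearMap.fderiv]
  rcases Nat.lt_or_ge i 2 with hi | hi
  · interval_cases i
    · simp [norm_iteratedFDeriv_zero]
    · simp only [one_ne_zero, ↓reduceIte]
      rw [← norm_iteratedFDeriv_fderiv, norm_iteratedFDeriv_zero, hfd]
      exact ContinuousLinearMap.norm_snd_le ℝ ℝ ℝ
  · obtain ⟨j, rfl⟩ : ∃ j, i = j + 2 := ⟨i - 2, by omega⟩
    have hne : j + 2 ≠ 0 := by omega
    have hne1 : j + 2 ≠ 1 := by omega
    simp only [hne, hne1, ↓reduceIte]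
    rw [show j + 2 = (j + 1) + 1 by ring, ← norm_iteratedFDeriv_fderiv, hfd,
      iteratedFDeriv_const_of_ne (by omega : j + 1 ≠ 0)]
    simp

/-- Derivatives of `p ↦ dir p.1` on `ℝ × ℝ` are bounded by `1`. -/
theorem norm_iteratedFDeriv_dir_fst_le (m : ℕ) (p : ℝ × ℝ) : ‖iteratedFDeriv ℝ m (fun p : ℝ × ℝ => dir p.1) p‖ ≤ 1 := by
  set F := (ContinuousLinearMap.fst ℝ ℝ ℝ) with hF
  have hfun : (fun p : ℝ × ℝ => dir p.1) = dir ∘ F := by funext p; simp [hF]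
  rw [hfun, ContinuousLinearMap.iteratedFDeriv_comp_right F contDiff_dir p (i := m) le_top]
  refine (ContinuousMultilinearMap.norm_compContinuousLinearMap_le _ _).trans ?_
  rw [Finset.prod_const, Finset.card_univ, Fintype.card_fin]
  calc ‖iteratedFDeriv ℝ m dir (F p)‖ * ‖F‖ ^ m ≤ 1 * 1 ^ m :=
        mul_le_mul (norm_iteratedFDeriv_dir_le m _) (pow_le_pow_left₀ (norm_nonneg _) (ContinuousLinearMap.norm_fst_le ℝ ℝ ℝ) m)
          (by positivity) zero_le_one
    _ = 1 := by simp

/-- The binomial sum of the polar map's Leibniz bound: `Σ_i C(n,i)·c_i ≤ |t| + n` for `c₀ = |t|`, `c₁ = 1`, `c_{≥2} = 0`. -/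
theorem sum_choose_snd_weights_le (n : ℕ) (t : ℝ) :
    ∑ i ∈ range (n + 1), (n.choose i : ℝ) * (if i = 0 then |t| else if i = 1 then 1 else 0) ≤ |t| + n := by
  rcases Nat.eq_zero_or_pos n with rfl | hn
  · simp
  · obtain ⟨m, rfl⟩ : ∃ m, n = m + 1 := ⟨n - 1, by omega⟩
    rw [sum_range_succ', sum_range_succ']
    have hrest : ∑ i ∈ range m, ((m + 1).choose (i + 1 + 1) : ℝ) *
        (if i + 1 + 1 = 0 then |t| else if i + 1 + 1 = 1 then 1 else 0) = 0 := by
      refine sum_eq_zero fun i _ => ?_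
      simp
    rw [hrest]
    simp only [Nat.choose_zero_right, Nat.cast_one, one_mul, ↓reduceIte, Nat.choose_one_right, Nat.cast_add,
      Nat.cast_one, zero_add, one_ne_zero, mul_one]
    linarith

/-- **Derivatives of the polar map** `P(θ,t) = t·dir θ` on `ℝ × ℝ`: `‖Dⁿ P(θ,t)‖ ≤ |t| + n`. -/
theorem norm_iteratedFDeriv_polar_le (n : ℕ) (p : ℝ × ℝ) :
    ‖iteratedFDeriv ℝ n (fun p : ℝ × ℝ => p.2 • dir p.1) p‖ ≤ |p.2| + n := by
  have hf : ContDiff ℝ (n : WithTop ℕ∞) (fun p : ℝ × ℝ => p.2) := contDiff_snd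
  have hg : ContDiff ℝ (n : WithTop ℕ∞) (fun p : ℝ × ℝ => dir p.1) := contDiff_dir.comp contDiff_fst
  have hL := norm_iteratedFDeriv_smul_le (N := (n : WithTop ℕ∞)) hf hg p (n := n) le_rfl
  refine hL.trans ((sum_le_sum fun i _ => ?_).trans (sum_choose_snd_weights_le n p.2))
  have h1 := norm_iteratedFDeriv_snd_le i p
  have h2 := norm_iteratedFDeriv_dir_fst_le (n - i) p
  have h0 : 0 ≤ (if i = 0 then |p.2| else if i = 1 then (1 : ℝ) else 0) := by
    split_ifs <;> positivity
  calc (n.choose i : ℝ) * ‖iteratedFDeriv ℝ i (fun p : ℝ × ℝ => p.2) p‖ *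
        ‖iteratedFDeriv ℝ (n - i) (fun p : ℝ × ℝ => dir p.1) p‖
      ≤ (n.choose i : ℝ) * (if i = 0 then |p.2| else if i = 1 then 1 else 0) * 1 := by
        gcongr
    _ = (n.choose i : ℝ) * (if i = 0 then |p.2| else if i = 1 then 1 else 0) := mul_one _

/-- The polar map is smooth. -/
theorem contDiff_polar {m : WithTop ℕ∞} : ContDiff ℝ m (fun p : ℝ × ℝ => p.2 • dir p.1) :=
  contDiff_snd.smul (contDiff_dir.comp contDiff_fst)

/-- **Derivative bounds of the perturbed level function** `G(θ,t) = ε₀(t·dir θ) + δ_K(t·dir θ)` on `ℝ × ℝ`: if `‖Dʲ(frameShift K)‖ ≤ A'` on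
`Momentum` for `j ≤ 4`, then for `1 ≤ j ≤ 4` and `|t| ≤ 5`: `‖Dʲ G(θ,t)‖ ≤ 24·(4 + 16A')·9ʲ`. -/
theorem norm_iteratedFDeriv_pertLevel_le {K : TrigPolyC4v} {A' : ℝ}
    (hA : ∀ p : Momentum, ∀ j ≤ 4, ‖iteratedFDeriv ℝ j (frameShift K) p‖ ≤ A') {j : ℕ} (hj : j ≤ 4) (p : ℝ × ℝ)
    (hp : |p.2| ≤ 5) :
    ‖iteratedFDeriv ℝ j (fun p : ℝ × ℝ => rayDispersion p + (fun k : Fin 2 → ℝ => -K.eval k) (p.2 • dir p.1)) p‖ ≤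
      (j.factorial : ℝ) * (4 + 16 * A') * 9 ^ j := by
  have hA0 : 0 ≤ A' := le_trans (norm_nonneg _) (hA 0 0 (by norm_num))
  -- `G = E ∘ P` with `E = ε₀ + δ_K` on `Fin 2 → ℝ`
  set E : (Fin 2 → ℝ) → ℝ := fun k => sqDispersion k + frameShift K (WithLp.toLp 2 k) with hE
  have hGE : (fun p : ℝ × ℝ => rayDispersion p + (fun k : Fin 2 → ℝ => -K.eval k) (p.2 • dir p.1)) =
      E ∘ fun p : ℝ × ℝ => p.2 • dir p.1 := by
    funext p; simp [hE, rayDispersion, frameShift_toLp]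
  have hEC : ContDiff ℝ ((4 : ℕ) : WithTop ℕ∞) E := contDiff_sqDispersion.add (contDiff_frameShift_toLp K)
  have hEb : ∀ i ≤ j, ‖iteratedFDeriv ℝ i E (p.2 • dir p.1)‖ ≤ 4 + 16 * A' := by
    intro i hi
    have hi4 : i ≤ 4 := hi.trans hj
    rw [hE, show (fun k : Fin 2 → ℝ => sqDispersion k + frameShift K (WithLp.toLp 2 k)) =
      sqDispersion + fun k : Fin 2 → ℝ => frameShift K (WithLp.toLp 2 k) from rfl,
      iteratedFDeriv_add_apply (contDiff_sqDispersion.contDiffAt (n := (i : WithTop ℕ∞)))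
      ((contDiff_frameShift_toLp K).contDiffAt (n := (i : WithTop ℕ∞)))]
    refine (norm_add_le _ _).trans (add_le_add (norm_iteratedFDeriv_sqDispersion_le i _) ?_)
    refine (norm_iteratedFDeriv_frameShift_toLp_le_of_order hA _ hi4).trans ?_
    have : (2 : ℝ) ^ i ≤ 2 ^ 4 := pow_le_pow_right₀ (by norm_num) hi4
    nlinarith
  rw [hGE]
  refine (norm_iteratedFDeriv_comp_le (N := ((4 : ℕ) : WithTop ℕ∞)) hEC contDiff_polar (by exact_mod_cast hj) p hEb
    fun i hi1 hi2 => ?_).trans le_rfl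
  refine (norm_iteratedFDeriv_polar_le i p).trans ?_
  have hi4 : (i : ℝ) ≤ 4 := by exact_mod_cast hi2.trans hj
  calc |p.2| + (i : ℝ) ≤ 9 := by linarith
    _ ≤ 9 ^ i := le_self_pow₀ (by norm_num) (by omega)

/-! ## §2 The partials `∂_θ G`, `∂_t G` as `C³` functions bounded through `D^{≤4} G` -/

section Partials

variable (K : TrigPolyC4v)

/-- p4's closed form of `∂_θ G` IS the Fréchet partial `DG(θ,t)[(1,0)]` of `G(θ,t) = ε₀(t·dir θ) + δ_K(t·dir θ)`. -/
theorem pertLevel_angle_eq_fderiv (p : ℝ × ℝ) :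
    rayDispersionDθ p.1 p.2 + fderiv ℝ (fun k : Fin 2 → ℝ => -K.eval k) (p.2 • dir p.1) (p.2 • dir (p.1 + π / 2)) =
      fderiv ℝ (fun p : ℝ × ℝ => rayDispersion p + (fun k : Fin 2 → ℝ => -K.eval k) (p.2 • dir p.1)) p ((1 : ℝ), (0 : ℝ)) := by
  have hδ : ContDiff ℝ 1 (fun k : Fin 2 → ℝ => -K.eval k) := by
    rw [← frameShift_toLp_eq_neg_eval]; exact contDiff_frameShift_toLp K
  have hd : DifferentiableAt ℝ (fun k : Fin 2 → ℝ => -K.eval k) (p.2 • dir p.1) := (hδ.differentiable (by norm_num)) _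
  have h1 := hasDerivAt_pertLevel_angle (θ := p.1) (t := p.2) hd
  have hG : DifferentiableAt ℝ (fun p : ℝ × ℝ => rayDispersion p + (fun k : Fin 2 → ℝ => -K.eval k) (p.2 • dir p.1)) p :=
    ((contDiff_pertLevel hδ).differentiable (by norm_num)) p
  have hline : HasDerivAt (fun ϑ : ℝ => (ϑ, p.2)) ((1 : ℝ), (0 : ℝ)) p.1 :=
    (hasDerivAt_id p.1).prodMk (hasDerivAt_const p.1 p.2)
  have h2 := hG.hasFDerivAt.comp_hasDerivAt p.1 hline
  exact h1.unique h2

/-- p4's closed form of `∂_t G` IS the Fréchet partial `DG(θ,t)[(0,1)]`. -/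
theorem pertLevel_radius_eq_fderiv (p : ℝ × ℝ) :
    rayDispersionDt p.1 p.2 + fderiv ℝ (fun k : Fin 2 → ℝ => -K.eval k) (p.2 • dir p.1) (dir p.1) =
      fderiv ℝ (fun p : ℝ × ℝ => rayDispersion p + (fun k : Fin 2 → ℝ => -K.eval k) (p.2 • dir p.1)) p ((0 : ℝ), (1 : ℝ)) := by
  have hδ : ContDiff ℝ 1 (fun k : Fin 2 → ℝ => -K.eval k) := by
    rw [← frameShift_toLp_eq_neg_eval]; exact contDiff_frameShift_toLp K
  have hd : DifferentiableAt ℝ (fun k : Fin 2 → ℝ => -K.eval k) (p.2 • dir p.1) := (hδ.differentiable (by norm_num)) _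
  have h1 := hasDerivAt_pertLevel_radius (θ := p.1) (t := p.2) hd
  have hG : DifferentiableAt ℝ (fun p : ℝ × ℝ => rayDispersion p + (fun k : Fin 2 → ℝ => -K.eval k) (p.2 • dir p.1)) p :=
    ((contDiff_pertLevel hδ).differentiable (by norm_num)) p
  have hline : HasDerivAt (fun s : ℝ => (p.1, s)) ((0 : ℝ), (1 : ℝ)) p.2 :=
    (hasDerivAt_const p.2 p.1).prodMk (hasDerivAt_id p.2)
  have h2 := hG.hasFDerivAt.comp_hasDerivAt p.2 hline
  exact h1.unique h2

/-- A Fréchet partial `p ↦ DG(p)[v]` of the level function is `C³`. -/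
theorem contDiff_pertLevel_partial (v : ℝ × ℝ) :
    ContDiff ℝ 3 fun p : ℝ × ℝ =>
      fderiv ℝ (fun p : ℝ × ℝ => rayDispersion p + (fun k : Fin 2 → ℝ => -K.eval k) (p.2 • dir p.1)) p v := by
  have hδ : ContDiff ℝ 4 (fun k : Fin 2 → ℝ => -K.eval k) := by
    rw [← frameShift_toLp_eq_neg_eval]; exact contDiff_frameShift_toLp K
  have hG := contDiff_pertLevel hδ
  exact (hG.fderiv_right (m := 3) le_rfl).clm_apply contDiff_const

/-- **The partials are bounded through `D^{≤4}G`**: `‖Dⁱ(p ↦ DG(p)[v])(p)‖ ≤ ‖v‖·‖D^{i+1} G(p)‖` (`i ≤ 3`). -/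
theorem norm_iteratedFDeriv_pertLevel_partial_le (v : ℝ × ℝ) {i : ℕ} (hi : i ≤ 3) (p : ℝ × ℝ) :
    ‖iteratedFDeriv ℝ i (fun p : ℝ × ℝ =>
        fderiv ℝ (fun p : ℝ × ℝ => rayDispersion p + (fun k : Fin 2 → ℝ => -K.eval k) (p.2 • dir p.1)) p v) p‖ ≤
      ‖v‖ * ‖iteratedFDeriv ℝ (i + 1) (fun p : ℝ × ℝ => rayDispersion p + (fun k : Fin 2 → ℝ => -K.eval k) (p.2 • dir p.1)) p‖ := by
  have hδ : ContDiff ℝ 4 (fun k : Fin 2 → ℝ => -K.eval k) := by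
    rw [← frameShift_toLp_eq_neg_eval]; exact contDiff_frameShift_toLp K
  have hG := contDiff_pertLevel hδ
  have hF : ContDiff ℝ 3 (fderiv ℝ (fun p : ℝ × ℝ => rayDispersion p + (fun k : Fin 2 → ℝ => -K.eval k) (p.2 • dir p.1))) :=
    hG.fderiv_right (m := 3) le_rfl
  rw [← norm_iteratedFDeriv_fderiv]
  exact norm_iteratedFDeriv_clm_apply_const (N := ((3 : ℕ) : WithTop ℕ∞)) hF.contDiffAt (by exact_mod_cast hi)

end Partials

end Summit.HubbardSuperconductivity.HubbardSuperconductivity.Theorems.PerturbedFermiCurve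

end
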